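import Summits.BirchSwinnertonDyer.BirchSwinnertonDyer.Theorems.EisensteinPrimesMazurMCOnCellBTwistbackSubrowReducedBalance
import HarnessLib

/-!
# Crux 3 `MazurMCOnCellB` (stmt-BirchSwinnertonDyer-19033), line `twistback` v5 — the LOCAL BALANCE AT A PLACE WHERE
# THE LINE CHARACTERS ARE UNRAMIFIED (`v ∤ p`, `ℓ_v ∤ m`): the kernel's indicator pair is Greenberg–Vatsal's printed
# pair, and at `p = 3` it is EVALUATED by the residue of `ℓ` mod `3` — the additive terms left raw in w3 g10's reduced
# balance (p657428) and in LEAD g11's sub-row door (p655437); part 1 (algebra)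

Width seat bsd-line-x2-p1-w7 (gen 2), cell `bsd-eis` (run/shared/lean/pub/bsd-eis/), 2026-08-28. HONEST FRAMING:
Dirichlet-character / finite-sum algebra over tree THEOREMS (the Weil relation of a rational line, LEAD g11's p652931
`apply_mul_apply_eq_natCast_of_line` + `level_dvd_of_line`; my g0's p652684 `dvd_iff_dvd_of_isPrimitive`; w3 g10's
p657428 `balance_iff_reduced_at_three`). THEOREMS ONLY (no `def`, no named fact introduced, no `sorry`, no named-fact
hypothesis); `--supports` stmt-BirchSwinnertonDyer-19033; closes no stub by itself; no summit statement, no Mazur main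
conjecture and no BSD is proved for any curve; 0 cells / labels / tiers move. The conditional DOORS consuming §3 and the
decoding of «balance = 1» are the sequel `…TwistbackSubrowEvaluatedBalance`.

WHY. On the sub-row «`p = 3`, `3` non-split» of crux 3 the (∃-PARTNER) conclusion of the registered stub 6′ is a
theorem of the tree modulo named facts and ONE per-pair identity, the local balance
`1 + Σ_{S₀} δ_W = Σ_{v ∈ S₀} s_ℓ·([φ(ℓ) = ℓ̄] + [ψ(ℓ) = ℓ̄])` (`ℓ = ℓ_v`, `ℓ̄ = ℓ mod 3`) for a rational `3`-line
`Φ₀ ≤ W[3]` presented by primitive characters `φ` (mod `m`) on the line and `ψ` (mod `d`) on the quotient (LEAD g11's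
p655437; v5/v6 `upperPartner_onSubrow`). w3 g10 (p657428 `balance_iff_reduced_at_three`) evaluated every MULTIPLICATIVE
place (`δ + s_ℓ·[split]`) and every additive place where the characters ramify (`0`), leaving RAW exactly the additive
places `v` with `ℓ ∤ m` (unramified characters; Kodaira IV / IV* places). This file evaluates those:

* §1 (every `p`, every prime `ℓ ≠ p` with `ℓ ∤ m`, NO reduction-type hypothesis): by the Weil relation
  `φ(ℓ)ψ(ℓ) = ℓ̄`, `[φ(ℓ) = ℓ̄] ↔ [ψ(ℓ) = 1]` and `[ψ(ℓ) = ℓ̄] ↔ [φ(ℓ) = 1]`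
  (`apply_sub_eq_natCast_iff_apply_quot_eq_one`, `apply_quot_eq_natCast_iff_apply_sub_eq_one`), so the kernel's term
  `s_ℓ([φ(ℓ)=ℓ̄] + [ψ(ℓ)=ℓ̄])` IS Greenberg–Vatsal's printed `s_ℓ([ψ(ℓ) = 1] + [ψ(ℓ) ≡ ℓ])` (GV §3 p. 43; LEAD g9's
  desk formula `Lines/twistback-lambda-formula-validation-g9.md`, 51/51) — `balanceTerm_eq_gvShape`.
* §2 (`p = 3`): `ℓ ≡ 2 (mod 3)` ⇒ the term is `s_ℓ` EXACTLY, character-free (`φ(ℓ)ψ(ℓ) = 2̄` has exactly one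
  factor `2̄`: `balanceTerm_eq_sFactor_of_mod_three_eq_two`); `ℓ ≡ 1 (mod 3)` ⇒ `φ(ℓ) = ψ(ℓ)` and the term is
  `2·s_ℓ·[ψ(ℓ) = 1]` (`balanceTerm_eq_two_mul_of_mod_three_eq_one`); uniformly `balanceTerm_eq_evaluated_at_three`.
* §3 (`p = 3`): the FULLY EVALUATED balance `balance_iff_evaluated_at_three`:
  `n + Σ_{S₀} δ = Σ_{S₀} term ↔ n = Σ_{S₀∖A} s_ℓ[split] + Σ_{v∈A, ℓ∤m, ℓ≡2(3)} s_ℓ + Σ_{v∈A, ℓ∤m, ℓ≡1(3)} 2s_ℓ[ψ(ℓ)=1]`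
  (`A ⊆ S₀` the additive places, `S₀ ∖ A` multiplicative), and its CHARACTER-FREE form
  `balance_iff_charFree_at_three` when no `A`-place with `ℓ ∤ m` has `ℓ ≡ 1 (mod 3)` (the case at every
  additive-unramified place of LEAD g9's 51-cell validation table: `ℓ ∈ {2, 5, 11, 17}`). The only character VALUES left
  in the sub-row identity are `ψ(ℓ)` at additive-unramified places with `ℓ ≡ 1 (mod 3)`.

References: [GreenbergVatsal2000] §2 Prop. (2.4) (p. 22), p. 28 ("`φψ = ω`"), §3 Thm. (3.11) and p. 43;
[Washington1997] Ch. 3 (conductors); [SilvermanAEC2009] III.8 (Weil pairing, `det ρ̄ = χ_p`).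
-/

set_option autoImplicit false
-- `Summit.BirchSwinnertonDyer.BirchSwinnertonDyer.…`: the summit and its single sub-problem share a name.
set_option linter.dupNamespace false

noncomputable section

open scoped Classical

open NumberField IsDedekindDomain Field WeierstrassCurve DirichletCharacter
  Literature.NumberTheory.EllipticCurves Literature.NumberTheory.GaloisRepresentations
  Literature.NumberTheory.EllipticCurves.GreenbergVatsal2000
  Literature.NumberTheory.EllipticCurves.Rank1Residual Literature.NumberTheory.EllipticCurves.Rank1Residual.Typed
  Summit.BirchSwinnertonDyer.Rank1Residual Summit.BirchSwinnertonDyer.Rank1Residual.X2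
  Summit.BirchSwinnertonDyer.BirchSwinnertonDyer.Theorems.EisensteinPrimesLineWeilRelation
  Summit.BirchSwinnertonDyer.BirchSwinnertonDyer.Theorems.EisensteinPrimesLineCharactersWeilRelation
  Summit.BirchSwinnertonDyer.BirchSwinnertonDyer.Theorems.EisensteinPrimesLineCharactersUnramifiedAtMultiplicativePlace
  Summit.BirchSwinnertonDyer.BirchSwinnertonDyer.Theorems.EisensteinPrimesMazurMCOnCellBTwistbackSubrowReducedBalance

namespace Summit.BirchSwinnertonDyer.BirchSwinnertonDyer.Theorems.EisensteinPrimesLocalBalanceAtUnramifiedPlace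

variable {W : WeierstrassCurve ℚ} [W.IsElliptic] {p : ℕ} [hp : Fact p.Prime]
  {Φ₀ : AddSubgroup (geomTorsion W (p : ℤ))}
  {m : ℕ} [NeZero m] {φ : DirichletCharacter (ZMod p) m} {d : ℕ} [NeZero d] {ψ : DirichletCharacter (ZMod p) d}

/-! ## §1. Every `p`: the indicator pair at a prime `ℓ ≠ p` not dividing the levels -/

/-- **The Weil relation at an unramified prime**: for a rational `p`-line with PRIMITIVE presenting characters
`(φ mod m, ψ mod d)` and a prime `ℓ ≠ p` with `ℓ ∤ m` (hence `ℓ ∤ d`): `φ(ℓ)·ψ(ℓ) = ℓ̄` in `𝔽_p`, and `ψ(ℓ) ≠ 0`,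
`ℓ̄ ≠ 0`. [cite: GreenbergVatsal2000, §2 p. 28 ("φψ = ω")] [cite: SilvermanAEC2009, III.8 Prop. 8.1] -/
theorem apply_mul_apply_eq_natCast_of_not_dvd (hΦ : IsRationalLine W p Φ₀) (hφ : φ.IsPrimitive)
    (hψ : ψ.IsPrimitive)
    (hφ0 : ∀ (σ : absoluteGaloisGroup ℚ), ∀ P ∈ Φ₀,
      σ • P = (φ ((modNCyclotomicCharacter ℚ m σ : (ZMod m)ˣ) : ZMod m)).val • P)
    (hψ0 : ∀ (σ : absoluteGaloisGroup ℚ) (Q : geomTorsion W (p : ℤ)),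
      σ • Q - (ψ ((modNCyclotomicCharacter ℚ d σ : (ZMod d)ˣ) : ZMod d)).val • Q ∈ Φ₀)
    {ℓ : ℕ} (hℓ : ℓ.Prime) (hℓp : ℓ ≠ p) (hℓm : ¬ ℓ ∣ m) :
    φ (ℓ : ZMod m) * ψ (ℓ : ZMod d) = (ℓ : ZMod p) ∧ ψ (ℓ : ZMod d) ≠ 0 ∧ (ℓ : ZMod p) ≠ 0 := by
  have hℓd : ¬ ℓ ∣ d := fun h ↦ hℓm ((dvd_iff_dvd_of_isPrimitive hΦ φ ψ hφ0 hψ0 hφ hψ hℓ hℓp).mpr h)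
  have hcm : ℓ.Coprime m := (Nat.Prime.coprime_iff_not_dvd hℓ).mpr hℓm
  have hcd : ℓ.Coprime d := (Nat.Prime.coprime_iff_not_dvd hℓ).mpr hℓd
  have hcp : ℓ.Coprime p := (Nat.coprime_primes hℓ hp.out).mpr hℓp
  have hb : ℓ.Coprime (m * d * p) := (hcm.mul_right hcd).mul_right hcp
  refine ⟨apply_mul_apply_eq_natCast_of_line hΦ hφ0 hψ0 hb, ?_, ?_⟩
  · rw [← ZMod.coe_unitOfCoprime ℓ hcd]; exact (IsUnit.map ψ (Units.isUnit _)).ne_zero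
  · rw [Ne, ZMod.natCast_eq_zero_iff]
    exact fun h ↦ hℓp ((Nat.prime_dvd_prime_iff_eq hp.out hℓ).mp h).symm

/-- **`[φ(ℓ) = ℓ̄] ↔ [ψ(ℓ) = 1]`** at a prime `ℓ ≠ p` with `ℓ ∤ m` (from `φ(ℓ)ψ(ℓ) = ℓ̄`, `ℓ̄ ≠ 0`): the kernel's
first indicator is Greenberg–Vatsal's `[ψ(ℓ) = 1]`. [cite: GreenbergVatsal2000, §2 p. 28 and §3 p. 43] -/
theorem apply_sub_eq_natCast_iff_apply_quot_eq_one (hΦ : IsRationalLine W p Φ₀) (hφ : φ.IsPrimitive)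
    (hψ : ψ.IsPrimitive)
    (hφ0 : ∀ (σ : absoluteGaloisGroup ℚ), ∀ P ∈ Φ₀,
      σ • P = (φ ((modNCyclotomicCharacter ℚ m σ : (ZMod m)ˣ) : ZMod m)).val • P)
    (hψ0 : ∀ (σ : absoluteGaloisGroup ℚ) (Q : geomTorsion W (p : ℤ)),
      σ • Q - (ψ ((modNCyclotomicCharacter ℚ d σ : (ZMod d)ˣ) : ZMod d)).val • Q ∈ Φ₀)
    {ℓ : ℕ} (hℓ : ℓ.Prime) (hℓp : ℓ ≠ p) (hℓm : ¬ ℓ ∣ m) :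
    φ (ℓ : ZMod m) = (ℓ : ZMod p) ↔ ψ (ℓ : ZMod d) = 1 := by
  obtain ⟨hW, hψ0', hℓ0⟩ := apply_mul_apply_eq_natCast_of_not_dvd hΦ hφ hψ hφ0 hψ0 hℓ hℓp hℓm
  constructor
  · intro h
    rw [h] at hW
    -- `ℓ̄ · ψ(ℓ) = ℓ̄` with `ℓ̄ ≠ 0`
    exact mul_left_cancel₀ hℓ0 (hW.trans (mul_one _).symm)
  · intro h
    rw [h, mul_one] at hW
    exact hW

/-- **`[ψ(ℓ) = ℓ̄] ↔ [φ(ℓ) = 1]`** at a prime `ℓ ≠ p` with `ℓ ∤ m` (the symmetric statement).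
[cite: GreenbergVatsal2000, §2 p. 28 and §3 p. 43] -/
theorem apply_quot_eq_natCast_iff_apply_sub_eq_one (hΦ : IsRationalLine W p Φ₀) (hφ : φ.IsPrimitive)
    (hψ : ψ.IsPrimitive)
    (hφ0 : ∀ (σ : absoluteGaloisGroup ℚ), ∀ P ∈ Φ₀,
      σ • P = (φ ((modNCyclotomicCharacter ℚ m σ : (ZMod m)ˣ) : ZMod m)).val • P)
    (hψ0 : ∀ (σ : absoluteGaloisGroup ℚ) (Q : geomTorsion W (p : ℤ)),
      σ • Q - (ψ ((modNCyclotomicCharacter ℚ d σ : (ZMod d)ˣ) : ZMod d)).val • Q ∈ Φ₀)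
    {ℓ : ℕ} (hℓ : ℓ.Prime) (hℓp : ℓ ≠ p) (hℓm : ¬ ℓ ∣ m) :
    ψ (ℓ : ZMod d) = (ℓ : ZMod p) ↔ φ (ℓ : ZMod m) = 1 := by
  obtain ⟨hW, hψ0', hℓ0⟩ := apply_mul_apply_eq_natCast_of_not_dvd hΦ hφ hψ hφ0 hψ0 hℓ hℓp hℓm
  constructor
  · intro h
    rw [h] at hW
    exact mul_right_cancel₀ hℓ0 (hW.trans (one_mul _).symm)
  · intro h
    rw [h, one_mul] at hW
    exact hW

/-- **The kernel's balance term IS Greenberg–Vatsal's printed term**: at a prime `ℓ ≠ p` with `ℓ ∤ m`,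
`s_ℓ[φ(ℓ) = ℓ̄] + s_ℓ[ψ(ℓ) = ℓ̄] = s_ℓ[ψ(ℓ) = 1] + s_ℓ[ψ(ℓ) = ℓ̄]` — GV §3 p. 43 «the `λ`-invariant of
`𝒫_ℓ(φ)·𝒫_ℓ(ψ)` is `s_ℓ` times the number of the characters `ψ⁻¹ω = φ… , ψ` trivial at `ℓ`», LEAD g9's desk formula
`s_ℓ([ψ(ℓ) = 1] + [ψ(ℓ) ≡ ℓ])`, now a theorem of the presentation for every curve. [cite: GreenbergVatsal2000, §3 p. 43] -/
theorem balanceTerm_eq_gvShape (hΦ : IsRationalLine W p Φ₀) (hφ : φ.IsPrimitive) (hψ : ψ.IsPrimitive)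
    (hφ0 : ∀ (σ : absoluteGaloisGroup ℚ), ∀ P ∈ Φ₀,
      σ • P = (φ ((modNCyclotomicCharacter ℚ m σ : (ZMod m)ˣ) : ZMod m)).val • P)
    (hψ0 : ∀ (σ : absoluteGaloisGroup ℚ) (Q : geomTorsion W (p : ℤ)),
      σ • Q - (ψ ((modNCyclotomicCharacter ℚ d σ : (ZMod d)ˣ) : ZMod d)).val • Q ∈ Φ₀)
    {ℓ : ℕ} (hℓ : ℓ.Prime) (hℓp : ℓ ≠ p) (hℓm : ¬ ℓ ∣ m) (s : ℕ) :
    ((if φ (ℓ : ZMod m) = (ℓ : ZMod p) then s else 0) + (if ψ (ℓ : ZMod d) = (ℓ : ZMod p) then s else 0)) =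
      (if ψ (ℓ : ZMod d) = 1 then s else 0) + (if ψ (ℓ : ZMod d) = (ℓ : ZMod p) then s else 0) := by
  have hiff := apply_sub_eq_natCast_iff_apply_quot_eq_one hΦ hφ hψ hφ0 hψ0 hℓ hℓp hℓm
  by_cases h : ψ (ℓ : ZMod d) = 1
  · rw [if_pos (hiff.mpr h), if_pos h]
  · rw [if_neg (fun h' ↦ h (hiff.mp h')), if_neg h]

/-! ## §2. `p = 3`: the term by the residue of `ℓ` modulo `3` -/

section Three

variable {Φ₃ : AddSubgroup (geomTorsion W (3 : ℤ))}
  {φ₃ : DirichletCharacter (ZMod 3) m} {ψ₃ : DirichletCharacter (ZMod 3) d}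

/-- In `𝔽₃`: a non-zero element squares to `1`. [folklore] -/
theorem mul_self_eq_one_of_ne_zero_zmod_three : ∀ y : ZMod 3, y ≠ 0 → y * y = 1 := by
  decide

/-- The residue of a natural number `ℓ` in `𝔽₃` is `2̄` iff `ℓ % 3 = 2`, and `1̄` iff `ℓ % 3 = 1`. [folklore] -/
theorem natCast_zmod_three_eq_iff (ℓ : ℕ) :
    ((ℓ : ZMod 3) = 2 ↔ ℓ % 3 = 2) ∧ ((ℓ : ZMod 3) = 1 ↔ ℓ % 3 = 1) := by
  have h3 : (ℓ : ZMod 3) = ((ℓ % 3 : ℕ) : ZMod 3) := (ZMod.natCast_mod ℓ 3).symm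
  have hlt : ℓ % 3 < 3 := Nat.mod_lt ℓ (by norm_num)
  rw [h3]
  constructor
  · constructor
    · intro h
      have := (ZMod.natCast_eq_natCast_iff' (ℓ % 3) 2 3).mp (by simpa using h)
      simpa [Nat.mod_eq_of_lt hlt] using this
    · intro h; rw [h]; rfl
  · constructor
    · intro h
      have := (ZMod.natCast_eq_natCast_iff' (ℓ % 3) 1 3).mp (by simpa using h)
      simpa [Nat.mod_eq_of_lt hlt] using this
    · intro h; rw [h]; rfl

/-- **`p = 3`, `ℓ ≡ 2 (mod 3)`, `ℓ ∤ m`: the balance term is `s` EXACTLY** (character-free). `φ(ℓ)ψ(ℓ) = 2̄` in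
`𝔽₃` has exactly one factor `2̄` (w3 g10's `eq_two_xor_of_mul_eq_two`). No reduction-type hypothesis: applies at an
ADDITIVE place with unramified characters (Kodaira IV / IV*) as well as at a good place put into `S₀`.
[cite: GreenbergVatsal2000, §2 p. 28 (φψ = ω) and §3 p. 43] -/
theorem balanceTerm_eq_sFactor_of_mod_three_eq_two (hΦ : IsRationalLine W 3 Φ₃) (hφ : φ₃.IsPrimitive)
    (hψ : ψ₃.IsPrimitive)
    (hφ0 : ∀ (σ : absoluteGaloisGroup ℚ), ∀ P ∈ Φ₃,
      σ • P = (φ₃ ((modNCyclotomicCharacter ℚ m σ : (ZMod m)ˣ) : ZMod m)).val • P)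
    (hψ0 : ∀ (σ : absoluteGaloisGroup ℚ) (Q : geomTorsion W (3 : ℤ)),
      σ • Q - (ψ₃ ((modNCyclotomicCharacter ℚ d σ : (ZMod d)ˣ) : ZMod d)).val • Q ∈ Φ₃)
    {ℓ : ℕ} (hℓ : ℓ.Prime) (hℓm : ¬ ℓ ∣ m) (hℓ2 : (ℓ : ZMod 3) = 2) (s : ℕ) :
    ((if φ₃ (ℓ : ZMod m) = (ℓ : ZMod 3) then s else 0) + (if ψ₃ (ℓ : ZMod d) = (ℓ : ZMod 3) then s else 0)) =
      s := by
  haveI : Fact (Nat.Prime 3) := ⟨Nat.prime_three⟩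
  have hℓ3 : ℓ ≠ 3 := by rintro rfl; exact absurd hℓ2 (by decide)
  obtain ⟨hW, -, -⟩ := apply_mul_apply_eq_natCast_of_not_dvd hΦ hφ hψ hφ0 hψ0 hℓ hℓ3 hℓm
  rw [hℓ2] at hW ⊢
  rcases eq_two_xor_of_mul_eq_two _ _ hW with ⟨h1, h2⟩ | ⟨h1, h2⟩
  · rw [if_pos h1, if_neg h2, add_zero]
  · rw [if_neg h1, if_pos h2, zero_add]

/-- **`p = 3`, `ℓ ≡ 1 (mod 3)`, `ℓ ∤ m`: `φ(ℓ) = ψ(ℓ)` and the balance term is `2·s·[ψ(ℓ) = 1]`**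
(`φ(ℓ)ψ(ℓ) = 1̄` and `ψ(ℓ)² = 1̄` in `𝔽₃`). So at an additive-unramified place with `ℓ ≡ 1 (3)` the term is `0` or
`2s_ℓ`, decided by ONE character value. [cite: GreenbergVatsal2000, §2 p. 28 (φψ = ω) and §3 p. 43] -/
theorem balanceTerm_eq_two_mul_of_mod_three_eq_one (hΦ : IsRationalLine W 3 Φ₃) (hφ : φ₃.IsPrimitive)
    (hψ : ψ₃.IsPrimitive)
    (hφ0 : ∀ (σ : absoluteGaloisGroup ℚ), ∀ P ∈ Φ₃,
      σ • P = (φ₃ ((modNCyclotomicCharacter ℚ m σ : (ZMod m)ˣ) : ZMod m)).val • P)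
    (hψ0 : ∀ (σ : absoluteGaloisGroup ℚ) (Q : geomTorsion W (3 : ℤ)),
      σ • Q - (ψ₃ ((modNCyclotomicCharacter ℚ d σ : (ZMod d)ˣ) : ZMod d)).val • Q ∈ Φ₃)
    {ℓ : ℕ} (hℓ : ℓ.Prime) (hℓm : ¬ ℓ ∣ m) (hℓ1 : (ℓ : ZMod 3) = 1) (s : ℕ) :
    φ₃ (ℓ : ZMod m) = ψ₃ (ℓ : ZMod d) ∧
    ((if φ₃ (ℓ : ZMod m) = (ℓ : ZMod 3) then s else 0) + (if ψ₃ (ℓ : ZMod d) = (ℓ : ZMod 3) then s else 0)) =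
      2 * (if ψ₃ (ℓ : ZMod d) = 1 then s else 0) := by
  haveI : Fact (Nat.Prime 3) := ⟨Nat.prime_three⟩
  have hℓ3 : ℓ ≠ 3 := by rintro rfl; exact absurd hℓ1 (by decide)
  obtain ⟨hW, hψne, -⟩ := apply_mul_apply_eq_natCast_of_not_dvd hΦ hφ hψ hφ0 hψ0 hℓ hℓ3 hℓm
  rw [hℓ1] at hW
  have hsq := mul_self_eq_one_of_ne_zero_zmod_three _ hψne
  -- `φ(ℓ) = ψ(ℓ)⁻¹ = ψ(ℓ)`
  have heq : φ₃ (ℓ : ZMod m) = ψ₃ (ℓ : ZMod d) := by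
    have h1 : φ₃ (ℓ : ZMod m) * ψ₃ (ℓ : ZMod d) = ψ₃ (ℓ : ZMod d) * ψ₃ (ℓ : ZMod d) := by rw [hW, hsq]
    exact mul_right_cancel₀ hψne h1
  refine ⟨heq, ?_⟩
  rw [hℓ1, heq]
  by_cases h : ψ₃ (ℓ : ZMod d) = 1
  · simp only [if_pos h]; ring
  · simp only [if_neg h]

/-- **`p = 3`, any prime `ℓ ≠ 3` with `ℓ ∤ m`: the balance term, EVALUATED** —
`s` if `ℓ % 3 = 2`, `2·s·[ψ(ℓ) = 1]` otherwise (then `ℓ % 3 = 1`). [cite: GreenbergVatsal2000, §2 p. 28 and §3 p. 43] -/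
theorem balanceTerm_eq_evaluated_at_three (hΦ : IsRationalLine W 3 Φ₃) (hφ : φ₃.IsPrimitive)
    (hψ : ψ₃.IsPrimitive)
    (hφ0 : ∀ (σ : absoluteGaloisGroup ℚ), ∀ P ∈ Φ₃,
      σ • P = (φ₃ ((modNCyclotomicCharacter ℚ m σ : (ZMod m)ˣ) : ZMod m)).val • P)
    (hψ0 : ∀ (σ : absoluteGaloisGroup ℚ) (Q : geomTorsion W (3 : ℤ)),
      σ • Q - (ψ₃ ((modNCyclotomicCharacter ℚ d σ : (ZMod d)ˣ) : ZMod d)).val • Q ∈ Φ₃)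
    {ℓ : ℕ} (hℓ : ℓ.Prime) (hℓ3 : ℓ ≠ 3) (hℓm : ¬ ℓ ∣ m) (s : ℕ) :
    ((if φ₃ (ℓ : ZMod m) = (ℓ : ZMod 3) then s else 0) + (if ψ₃ (ℓ : ZMod d) = (ℓ : ZMod 3) then s else 0)) =
      if ℓ % 3 = 2 then s else 2 * (if ψ₃ (ℓ : ZMod d) = 1 then s else 0) := by
  have hmod : ℓ % 3 = 1 ∨ ℓ % 3 = 2 := by
    have hlt : ℓ % 3 < 3 := Nat.mod_lt ℓ (by norm_num)
    have hne : ℓ % 3 ≠ 0 := by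
      intro h0
      have h3 : 3 ∣ ℓ := Nat.dvd_of_mod_eq_zero h0
      exact hℓ3 ((Nat.prime_dvd_prime_iff_eq Nat.prime_three hℓ).mp h3).symm
    omega
  obtain ⟨h2iff, h1iff⟩ := natCast_zmod_three_eq_iff ℓ
  rcases hmod with h1 | h2
  · rw [if_neg (show ¬ ℓ % 3 = 2 by omega)]
    exact (balanceTerm_eq_two_mul_of_mod_three_eq_one hΦ hφ hψ hφ0 hψ0 hℓ hℓm (h1iff.mpr h1) s).2
  · rw [if_pos h2]
    exact balanceTerm_eq_sFactor_of_mod_three_eq_two hΦ hφ hψ hφ0 hψ0 hℓ hℓm (h2iff.mpr h2) s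

/-! ## §3. `p = 3`: the balance over `S₀` FULLY EVALUATED -/

/-- **The FULLY EVALUATED balance (`p = 3`).** `S₀ ∌ (3)` finite, `A ⊆ S₀` with every place of `A` ADDITIVE and every
place of `S₀ ∖ A` MULTIPLICATIVE for the globally minimal `W`; any rational `3`-line with primitive presenting characters
`(φ mod m, ψ mod d)`; any `n`. Then
`n + Σ_{S₀} δ = Σ_{S₀} term ↔ n = Σ_{S₀∖A} s_ℓ[split] + Σ_{v ∈ A} (0 if ℓ ∣ m; s_ℓ if ℓ % 3 = 2; 2s_ℓ[ψ(ℓ)=1] else)`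
(w3 g10's `balance_iff_reduced_at_three` + §2). The only character values left are `ψ(ℓ)` at the `A`-places with
`ℓ ∤ m` and `ℓ ≡ 1 (mod 3)`. [cite: GreenbergVatsal2000, §2 Prop. (2.4) (p. 22) and §3 p. 43] -/
theorem balance_iff_evaluated_at_three [W.IsGloballyMinimal] {S₀ A : Finset (HeightOneSpectrum (𝓞 ℚ))}
    (hAS : A ⊆ S₀) (hS₀p : ∀ v ∈ S₀, ((3 : ℕ) : 𝓞 ℚ) ∉ v.asIdeal)
    (hA : ∀ v ∈ A, W.HasAdditiveReductionAt v)
    (hmult : ∀ v ∈ S₀, v ∉ A → W.HasMultiplicativeReductionAt v)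
    (hΦ : IsRationalLine W 3 Φ₃) (hφ : φ₃.IsPrimitive) (hψ : ψ₃.IsPrimitive)
    (hφ0 : ∀ (σ : absoluteGaloisGroup ℚ), ∀ P ∈ Φ₃,
      σ • P = (φ₃ ((modNCyclotomicCharacter ℚ m σ : (ZMod m)ˣ) : ZMod m)).val • P)
    (hψ0 : ∀ (σ : absoluteGaloisGroup ℚ) (Q : geomTorsion W (3 : ℤ)),
      σ • Q - (ψ₃ ((modNCyclotomicCharacter ℚ d σ : (ZMod d)ˣ) : ZMod d)).val • Q ∈ Φ₃) (n : ℕ) :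
    (n + ∑ v ∈ S₀, delta W 3 v =
      ∑ v ∈ S₀, ((if φ₃ (Rat.HeightOneSpectrum.natGenerator v : ZMod m) =
            (Rat.HeightOneSpectrum.natGenerator v : ZMod 3)
          then sFactor 3 (Rat.HeightOneSpectrum.natGenerator v) else 0) +
        (if ψ₃ (Rat.HeightOneSpectrum.natGenerator v : ZMod d) =
            (Rat.HeightOneSpectrum.natGenerator v : ZMod 3)
          then sFactor 3 (Rat.HeightOneSpectrum.natGenerator v) else 0))) ↔
    (n = ∑ v ∈ S₀ \ A, (if W.HasSplitMultiplicativeReductionAt v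
          then sFactor 3 (Rat.HeightOneSpectrum.natGenerator v) else 0) +
      ∑ v ∈ A, (if Rat.HeightOneSpectrum.natGenerator v ∣ m then 0 else
        if Rat.HeightOneSpectrum.natGenerator v % 3 = 2 then sFactor 3 (Rat.HeightOneSpectrum.natGenerator v)
        else 2 * (if ψ₃ (Rat.HeightOneSpectrum.natGenerator v : ZMod d) = 1
          then sFactor 3 (Rat.HeightOneSpectrum.natGenerator v) else 0))) := by
  haveI : Fact (Nat.Prime 3) := ⟨Nat.prime_three⟩
  rw [balance_iff_reduced_at_three hAS hS₀p hA hmult hΦ hφ hψ hφ0 hψ0 n]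
  have hT : ∑ v ∈ A, (if Rat.HeightOneSpectrum.natGenerator v ∣ m then 0 else
        ((if φ₃ (Rat.HeightOneSpectrum.natGenerator v : ZMod m) =
            (Rat.HeightOneSpectrum.natGenerator v : ZMod 3)
          then sFactor 3 (Rat.HeightOneSpectrum.natGenerator v) else 0) +
        (if ψ₃ (Rat.HeightOneSpectrum.natGenerator v : ZMod d) =
            (Rat.HeightOneSpectrum.natGenerator v : ZMod 3)
          then sFactor 3 (Rat.HeightOneSpectrum.natGenerator v) else 0))) =
      ∑ v ∈ A, (if Rat.HeightOneSpectrum.natGenerator v ∣ m then 0 else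
        if Rat.HeightOneSpectrum.natGenerator v % 3 = 2 then sFactor 3 (Rat.HeightOneSpectrum.natGenerator v)
        else 2 * (if ψ₃ (Rat.HeightOneSpectrum.natGenerator v : ZMod d) = 1
          then sFactor 3 (Rat.HeightOneSpectrum.natGenerator v) else 0)) := by
    refine Finset.sum_congr rfl fun v hv ↦ ?_
    by_cases hℓm : Rat.HeightOneSpectrum.natGenerator v ∣ m
    · rw [if_pos hℓm, if_pos hℓm]
    · rw [if_neg hℓm, if_neg hℓm]
      have hℓ3 : Rat.HeightOneSpectrum.natGenerator v ≠ 3 := fun h ↦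
        not_natGenerator_dvd (p := 3) (hS₀p v (hAS hv)) (h ▸ dvd_rfl)
      exact balanceTerm_eq_evaluated_at_three hΦ hφ hψ hφ0 hψ0 (Rat.HeightOneSpectrum.prime_natGenerator v)
        hℓ3 hℓm _
  rw [hT]

/-- **The CHARACTER-FREE balance (`p = 3`)**: if no `A`-place with unramified characters (`ℓ ∤ m`) has
`ℓ ≡ 1 (mod 3)`, the balance reads `n = Σ_{S₀∖A} s_ℓ[split] + Σ_{v∈A, ℓ∤m} s_ℓ` — reduction types, the support of
`m`, and residues mod `3` and `9` only. [cite: GreenbergVatsal2000, §2 Prop. (2.4) (p. 22) and §3 p. 43] -/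
theorem balance_iff_charFree_at_three [W.IsGloballyMinimal] {S₀ A : Finset (HeightOneSpectrum (𝓞 ℚ))}
    (hAS : A ⊆ S₀) (hS₀p : ∀ v ∈ S₀, ((3 : ℕ) : 𝓞 ℚ) ∉ v.asIdeal)
    (hA : ∀ v ∈ A, W.HasAdditiveReductionAt v)
    (hmult : ∀ v ∈ S₀, v ∉ A → W.HasMultiplicativeReductionAt v)
    (hA1 : ∀ v ∈ A, ¬ Rat.HeightOneSpectrum.natGenerator v ∣ m → Rat.HeightOneSpectrum.natGenerator v % 3 = 2)
    (hΦ : IsRationalLine W 3 Φ₃) (hφ : φ₃.IsPrimitive) (hψ : ψ₃.IsPrimitive)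
    (hφ0 : ∀ (σ : absoluteGaloisGroup ℚ), ∀ P ∈ Φ₃,
      σ • P = (φ₃ ((modNCyclotomicCharacter ℚ m σ : (ZMod m)ˣ) : ZMod m)).val • P)
    (hψ0 : ∀ (σ : absoluteGaloisGroup ℚ) (Q : geomTorsion W (3 : ℤ)),
      σ • Q - (ψ₃ ((modNCyclotomicCharacter ℚ d σ : (ZMod d)ˣ) : ZMod d)).val • Q ∈ Φ₃) (n : ℕ) :
    (n + ∑ v ∈ S₀, delta W 3 v =
      ∑ v ∈ S₀, ((if φ₃ (Rat.HeightOneSpectrum.natGenerator v : ZMod m) =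
            (Rat.HeightOneSpectrum.natGenerator v : ZMod 3)
          then sFactor 3 (Rat.HeightOneSpectrum.natGenerator v) else 0) +
        (if ψ₃ (Rat.HeightOneSpectrum.natGenerator v : ZMod d) =
            (Rat.HeightOneSpectrum.natGenerator v : ZMod 3)
          then sFactor 3 (Rat.HeightOneSpectrum.natGenerator v) else 0))) ↔
    (n = ∑ v ∈ S₀ \ A, (if W.HasSplitMultiplicativeReductionAt v
          then sFactor 3 (Rat.HeightOneSpectrum.natGenerator v) else 0) +
      ∑ v ∈ A, (if Rat.HeightOneSpectrum.natGenerator v ∣ m then 0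
        else sFactor 3 (Rat.HeightOneSpectrum.natGenerator v))) := by
  rw [balance_iff_evaluated_at_three hAS hS₀p hA hmult hΦ hφ hψ hφ0 hψ0 n]
  have hT : ∑ v ∈ A, (if Rat.HeightOneSpectrum.natGenerator v ∣ m then 0 else
        if Rat.HeightOneSpectrum.natGenerator v % 3 = 2 then sFactor 3 (Rat.HeightOneSpectrum.natGenerator v)
        else 2 * (if ψ₃ (Rat.HeightOneSpectrum.natGenerator v : ZMod d) = 1
          then sFactor 3 (Rat.HeightOneSpectrum.natGenerator v) else 0)) =
      ∑ v ∈ A, (if Rat.HeightOneSpectrum.natGenerator v ∣ m then 0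
        else sFactor 3 (Rat.HeightOneSpectrum.natGenerator v)) := by
    refine Finset.sum_congr rfl fun v hv ↦ ?_
    by_cases hℓm : Rat.HeightOneSpectrum.natGenerator v ∣ m
    · rw [if_pos hℓm, if_pos hℓm]
    · rw [if_neg hℓm, if_neg hℓm, if_pos (hA1 v hv hℓm)]
  rw [hT]

end Three

end Summit.BirchSwinnertonDyer.BirchSwinnertonDyer.Theorems.EisensteinPrimesLocalBalanceAtUnramifiedPlace

end
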